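import Mathlib
import HarnessLib
import Summits.Ventures.LatticeQCDFlow.Scaling.TorusRankedThreeDim
import Summits.Ventures.LatticeQCDFlow.Scaling.TorusRankedParityBound

/-!
# LatticeQCDFlow / Scaling — the three-dimensional structure leaves exactly `L³ + 2` plaquettes outside;
# with the parity bound, the least number of uncovered plaquettes of `(ℤ/L)³` is pinned to
# `{L³ − 1, L³, L³ + 1, L³ + 2}`

HONEST FRAMING: exact (Metropolis-corrected) sampling algorithms for lattice gauge theory;
figures of merit are autocorrelation/cost numbers at stated couplings and volumes; no
continuum-physics claim.

Venture `LatticeQCDFlow` (cell pub-lqcd), topic `Scaling`, FANOUT row 30 (lean-1, GEN-24) — OUR WORK on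
THEORY-2.md §4 row C5; sequel to `TorusRankedThreeDim` (the structure `B` = layers ∪ bottom comb ∪ top
comb-tree is ranked with an injective top-link assignment).  Here the count and the assembly:

* §1 **`card_threeDim`** — `#B = 2L³ − 2`: by planes, `#{x : x₂ ≠ −1 ∨ x₀ ≠ −1} = L³ − L` (plane `(0,2)`),
  `#{x : x₂ ≠ −1 ∨ (x₀ = 0 ∧ x₁ ≠ −1)} = L³ − L² + (L − 1)` (plane `(1,2)`),
  `#{x : x₂ = 0, x ≠ (−1,−1,0)} = L² − 1` (plane `(0,1)`);
* §2 **`exists_ranked_three_card_compl`** — there is a ranked structure of `(ℤ/L)³` (`L ≥ 2`) with an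
  injective top-link assignment leaving EXACTLY `L³ + 2` plaquettes outside; **`threeDim_gap_le_three`** —
  together with `TorusRankedParityBound.pow_three_le_card_compl_add_one_of_ranked` (`L³ ≤ k + 1` for
  every ranked structure): the optimum `k_min` of three dimensions satisfies `L³ − 1 ≤ k_min ≤ L³ + 2`
  (the homological count `b₂ + #cubes − 1 = L³ + 2` of `H₂(T³; ℤ/2)` suggests the upper end is exact).

No `def`, no `sorry`, nothing cited as a fact beyond the tree.
-/

namespace Summit.Ventures.LatticeQCDFlow.Theory2.Autoregressive

open Finset
open Literature.MathematicalPhysics.QuantumFieldTheory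

variable {L : ℕ} [NeZero L]

/-! ## §1 Counting the structure -/

/-- Sites with prescribed coordinate sets: `#{x : x₀ ∈ s₀, x₁ ∈ s₁, x₂ ∈ s₂} = #s₀·#s₁·#s₂`. [folklore] -/
theorem card_filter_site_three (s₀ s₁ s₂ : Finset (ZMod L)) :
    ((Finset.univ : Finset (Site 3 L)).filter (fun x => x 0 ∈ s₀ ∧ x 1 ∈ s₁ ∧ x 2 ∈ s₂)).card =
      s₀.card * s₁.card * s₂.card := by
  classical
  set s : Fin 3 → Finset (ZMod L) := fun i => if i = 0 then s₀ else if i = 1 then s₁ else s₂ with hs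
  have h : (Finset.univ : Finset (Site 3 L)).filter (fun x => x 0 ∈ s₀ ∧ x 1 ∈ s₁ ∧ x 2 ∈ s₂) =
      Fintype.piFinset s := by
    ext x
    simp only [mem_filter, mem_univ, true_and, Fintype.mem_piFinset]
    constructor
    · rintro ⟨h0, h1, h2⟩ i
      fin_cases i
      · simpa [hs] using h0
      · simpa [hs] using h1
      · simpa [hs] using h2
    · intro h
      refine ⟨?_, ?_, ?_⟩
      · simpa [hs] using h 0
      · simpa [hs] using h 1
      · simpa [hs] using h 2
  rw [h, Fintype.card_piFinset, Fin.prod_univ_three]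
  simp [hs]

/-- `#{x : x₂ = a ∧ x₀ = b} = L`, `#{x : x₂ = a ∧ x₀ = b ∧ x₁ = c} = 1`, `#{x : x₂ = a ∧ x₀ = b ∧ x₁ ≠ c} = L − 1`,
`#{x : x₂ = a} = L²`: the fibre counts used below. [folklore] -/
theorem card_filter_site_fibres (a b c : ZMod L) :
    ((Finset.univ : Finset (Site 3 L)).filter (fun x => x 2 = a ∧ x 0 = b)).card = L ∧
    ((Finset.univ : Finset (Site 3 L)).filter (fun x => x 2 = a ∧ x 0 = b ∧ x 1 = c)).card = 1 ∧
    ((Finset.univ : Finset (Site 3 L)).filter (fun x => x 2 = a ∧ x 0 = b ∧ x 1 ≠ c)).card = L - 1 ∧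
    ((Finset.univ : Finset (Site 3 L)).filter (fun x => x 2 = a)).card = L ^ 2 := by
  classical
  have hL1 : ((Finset.univ : Finset (ZMod L)).erase c).card = L - 1 := by
    rw [card_erase_of_mem (mem_univ _), card_univ, ZMod.card]
  have hZ : (Finset.univ : Finset (ZMod L)).card = L := by rw [card_univ, ZMod.card]
  refine ⟨?_, ?_, ?_, ?_⟩
  · rw [show (Finset.univ : Finset (Site 3 L)).filter (fun x => x 2 = a ∧ x 0 = b) =
        (Finset.univ : Finset (Site 3 L)).filter (fun x => x 0 ∈ ({b} : Finset (ZMod L)) ∧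
          x 1 ∈ (Finset.univ : Finset (ZMod L)) ∧ x 2 ∈ ({a} : Finset (ZMod L))) from by
        ext x; simp only [mem_filter, mem_univ, true_and, mem_singleton]; tauto,
      card_filter_site_three, card_singleton, card_singleton, hZ, one_mul, mul_one]
  · rw [show (Finset.univ : Finset (Site 3 L)).filter (fun x => x 2 = a ∧ x 0 = b ∧ x 1 = c) =
        (Finset.univ : Finset (Site 3 L)).filter (fun x => x 0 ∈ ({b} : Finset (ZMod L)) ∧
          x 1 ∈ ({c} : Finset (ZMod L)) ∧ x 2 ∈ ({a} : Finset (ZMod L))) from by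
        ext x; simp only [mem_filter, mem_univ, true_and, mem_singleton]; tauto,
      card_filter_site_three, card_singleton, card_singleton, card_singleton]
  · rw [show (Finset.univ : Finset (Site 3 L)).filter (fun x => x 2 = a ∧ x 0 = b ∧ x 1 ≠ c) =
        (Finset.univ : Finset (Site 3 L)).filter (fun x => x 0 ∈ ({b} : Finset (ZMod L)) ∧
          x 1 ∈ (Finset.univ : Finset (ZMod L)).erase c ∧ x 2 ∈ ({a} : Finset (ZMod L))) from by
        ext x; simp only [mem_filter, mem_univ, true_and, mem_singleton, mem_erase, and_true]; tauto,
      card_filter_site_three, card_singleton, card_singleton, hL1, one_mul, mul_one]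
  · rw [show (Finset.univ : Finset (Site 3 L)).filter (fun x => x 2 = a) =
        (Finset.univ : Finset (Site 3 L)).filter (fun x => x 0 ∈ (Finset.univ : Finset (ZMod L)) ∧
          x 1 ∈ (Finset.univ : Finset (ZMod L)) ∧ x 2 ∈ ({a} : Finset (ZMod L))) from by
        ext x; simp only [mem_filter, mem_univ, true_and, mem_singleton],
      card_filter_site_three, card_singleton, hZ, mul_one, sq]

/-- **`#B = 2L³ − 2`** for the three-dimensional structure (`L ≥ 1`). [ours] -/
theorem card_threeDim (B : Finset (Plaquette 3 L))
    (hB : B = Finset.univ.filter (fun p : Plaquette 3 L =>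
      (p.2.1.2 = 2 ∧ (p.1 2 ≠ -1 ∨ (p.2.1.1 = 0 ∧ p.1 0 ≠ -1) ∨ (p.2.1.1 = 1 ∧ p.1 0 = 0 ∧ p.1 1 ≠ -1))) ∨
      (p.2.1.2 = 1 ∧ p.1 2 = 0 ∧ ¬ (p.1 0 = -1 ∧ p.1 1 = -1)))) :
    B.card + 2 = 2 * L ^ 3 := by
  classical
  subst hB
  have h12 : ¬ ((1 : Fin 3) = 2) := by decide
  have h10 : ¬ ((1 : Fin 3) = 0) := by decide
  have h01 : ¬ ((0 : Fin 3) = 1) := by decide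
  have h21 : ¬ ((2 : Fin 3) = 1) := by decide
  -- the three plane families as images of site filters
  set S01 : Finset (Site 3 L) := Finset.univ.filter (fun x => x 2 = 0 ∧ ¬ (x 0 = -1 ∧ x 1 = -1)) with hS01
  set S02 : Finset (Site 3 L) := Finset.univ.filter (fun x => x 2 ≠ -1 ∨ x 0 ≠ -1) with hS02
  set S12 : Finset (Site 3 L) := Finset.univ.filter (fun x => x 2 ≠ -1 ∨ (x 0 = 0 ∧ x 1 ≠ -1)) with hS12
  set e01 : Site 3 L ↪ Plaquette 3 L := ⟨fun x => (x, ⟨((0 : Fin 3), (1 : Fin 3)), by decide⟩),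
    fun x y h => congrArg Prod.fst h⟩ with he01
  set e02 : Site 3 L ↪ Plaquette 3 L := ⟨fun x => (x, ⟨((0 : Fin 3), (2 : Fin 3)), by decide⟩),
    fun x y h => congrArg Prod.fst h⟩ with he02
  set e12 : Site 3 L ↪ Plaquette 3 L := ⟨fun x => (x, ⟨((1 : Fin 3), (2 : Fin 3)), by decide⟩),
    fun x y h => congrArg Prod.fst h⟩ with he12
  have hdecomp : Finset.univ.filter (fun p : Plaquette 3 L =>
      (p.2.1.2 = 2 ∧ (p.1 2 ≠ -1 ∨ (p.2.1.1 = 0 ∧ p.1 0 ≠ -1) ∨ (p.2.1.1 = 1 ∧ p.1 0 = 0 ∧ p.1 1 ≠ -1))) ∨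
      (p.2.1.2 = 1 ∧ p.1 2 = 0 ∧ ¬ (p.1 0 = -1 ∧ p.1 1 = -1))) =
      S01.map e01 ∪ (S02.map e02 ∪ S12.map e12) := by
    ext p
    obtain ⟨x, q⟩ := p
    simp only [mem_filter, mem_univ, true_and, mem_union, mem_map, Function.Embedding.coeFn_mk, hS01, hS02,
      hS12, he01, he02, he12]
    rcases plane_three_cases q with rfl | rfl | rfl <;>
      simp only [h12, h10, h01, h21, false_and, false_or, or_false, true_and, Fin.isValue]
    · constructor
      · intro h; exact Or.inl ⟨x, h, rfl⟩
      · rintro (⟨a, ha, hax⟩ | ⟨a, -, hax⟩ | ⟨a, -, hax⟩)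
        · obtain rfl : a = x := congrArg Prod.fst hax; exact ha
        · have h2 := congrArg (fun r : Plaquette 3 L => r.2.1.2) hax; simp at h2
        · have h2 := congrArg (fun r : Plaquette 3 L => r.2.1.2) hax; simp at h2
    · constructor
      · intro h; exact Or.inr (Or.inl ⟨x, h, rfl⟩)
      · rintro (⟨a, -, hax⟩ | ⟨a, ha, hax⟩ | ⟨a, -, hax⟩)
        · have h2 := congrArg (fun r : Plaquette 3 L => r.2.1.2) hax; simp at h2
        · obtain rfl : a = x := congrArg Prod.fst hax; exact ha
        · have h2 := congrArg (fun r : Plaquette 3 L => r.2.1.1) hax; simp at h2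
    · constructor
      · intro h; exact Or.inr (Or.inr ⟨x, h, rfl⟩)
      · rintro (⟨a, -, hax⟩ | ⟨a, -, hax⟩ | ⟨a, ha, hax⟩)
        · have h2 := congrArg (fun r : Plaquette 3 L => r.2.1.2) hax; simp at h2
        · have h2 := congrArg (fun r : Plaquette 3 L => r.2.1.1) hax; simp at h2
        · obtain rfl : a = x := congrArg Prod.fst hax; exact ha
  have hd1 : Disjoint (S02.map e02) (S12.map e12) := by
    rw [Finset.disjoint_left]
    rintro p hp hp'
    simp only [mem_map, he02, he12, Function.Embedding.coeFn_mk] at hp hp'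
    obtain ⟨x, -, rfl⟩ := hp
    obtain ⟨y, -, h⟩ := hp'
    have h2 := congrArg (fun q : Plaquette 3 L => q.2.1.1) h; simp at h2
  have hd2 : Disjoint (S01.map e01) (S02.map e02 ∪ S12.map e12) := by
    rw [Finset.disjoint_left]
    rintro p hp hp'
    simp only [mem_map, mem_union, he01, he02, he12, Function.Embedding.coeFn_mk] at hp hp'
    obtain ⟨x, -, rfl⟩ := hp
    rcases hp' with ⟨y, -, h⟩ | ⟨y, -, h⟩ <;>
      (have h2 := congrArg (fun q : Plaquette 3 L => q.2.1.2) h; simp at h2)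
  rw [hdecomp, card_union_of_disjoint hd2, card_union_of_disjoint hd1, card_map, card_map, card_map]
  -- the three site counts
  obtain ⟨hA, hcorner, -, hplane⟩ := card_filter_site_fibres (L := L) 0 (-1) (-1)
  obtain ⟨hcol, -, htree, -⟩ := card_filter_site_fibres (L := L) (-1) 0 (-1)
  obtain ⟨hrow, -, -, -⟩ := card_filter_site_fibres (L := L) (-1) (-1) 0
  have hsite : Fintype.card (Site 3 L) = L ^ 3 := Summit.Ventures.LatticeQCDFlow.Runbook.card_site
  have hlast := card_filter_site_last_ne (n := 1) (L := L)
  -- S01 = {x₂ = 0} minus the corner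
  have h01c : S01.card + 1 = L ^ 2 := by
    have hsub : (Finset.univ : Finset (Site 3 L)).filter (fun x => x 2 = 0 ∧ x 0 = -1 ∧ x 1 = -1) ⊆
        (Finset.univ : Finset (Site 3 L)).filter (fun x => x 2 = 0) := by
      intro x hx; simp only [mem_filter, mem_univ, true_and] at hx ⊢; exact hx.1
    have heq : S01 = (Finset.univ : Finset (Site 3 L)).filter (fun x => x 2 = 0) \
        (Finset.univ : Finset (Site 3 L)).filter (fun x => x 2 = 0 ∧ x 0 = -1 ∧ x 1 = -1) := by
      ext x; simp only [hS01, mem_filter, mem_univ, true_and, mem_sdiff]; tauto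
    rw [heq, Finset.card_sdiff_of_subset hsub, hcorner, hplane]
    have : 1 ≤ L ^ 2 := Nat.one_le_pow _ _ (NeZero.pos L)
    omega
  -- S02 = all sites minus {x₂ = −1 ∧ x₀ = −1}
  have h02c : S02.card + L = L ^ 3 := by
    have heq : S02 = Finset.univ \ (Finset.univ : Finset (Site 3 L)).filter (fun x => x 2 = -1 ∧ x 0 = -1) := by
      ext x; simp only [hS02, mem_filter, mem_univ, true_and, mem_sdiff]; tauto
    rw [heq, card_univ_sdiff, hrow, hsite]
    have : L ≤ L ^ 3 := by
      calc L = L ^ 1 := (pow_one L).symm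
        _ ≤ L ^ 3 := Nat.pow_le_pow_right (NeZero.pos L) (by omega)
    omega
  -- S12 = {x₂ ≠ −1} ∪ {x₂ = −1, x₀ = 0, x₁ ≠ −1}
  have h12c : S12.card = (L - 1) * L ^ 2 + (L - 1) := by
    have heq : S12 = (Finset.univ : Finset (Site 3 L)).filter (fun x => x (Fin.last 2) ≠ -1) ∪
        (Finset.univ : Finset (Site 3 L)).filter (fun x => x 2 = -1 ∧ x 0 = 0 ∧ x 1 ≠ -1) := by
      ext x
      simp only [hS12, mem_filter, mem_univ, true_and, mem_union, show (Fin.last 2 : Fin 3) = 2 from rfl]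
      constructor
      · rintro (h | ⟨h0, h1⟩)
        · exact Or.inl h
        · by_cases h2 : x 2 = -1
          · exact Or.inr ⟨h2, h0, h1⟩
          · exact Or.inl h2
      · rintro (h | ⟨-, h0, h1⟩)
        · exact Or.inl h
        · exact Or.inr ⟨h0, h1⟩
    have hdisj : Disjoint ((Finset.univ : Finset (Site 3 L)).filter (fun x => x (Fin.last 2) ≠ -1))
        ((Finset.univ : Finset (Site 3 L)).filter (fun x => x 2 = -1 ∧ x 0 = 0 ∧ x 1 ≠ -1)) := by
      rw [Finset.disjoint_left]
      intro x hx hx'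
      simp only [mem_filter, mem_univ, true_and, show (Fin.last 2 : Fin 3) = 2 from rfl] at hx hx'
      exact hx hx'.1
    rw [heq, card_union_of_disjoint hdisj, hlast, htree]
  -- assemble: (L² − 1) + (L³ − L) + ((L−1)L² + L − 1) = 2L³ − 2
  have hL1 : 1 ≤ L := NeZero.pos L
  obtain ⟨M, rfl⟩ : ∃ M, L = M + 1 := ⟨L - 1, (Nat.sub_add_cancel hL1).symm⟩
  simp only [Nat.add_sub_cancel] at h12c
  rw [h12c]
  ring_nf
  ring_nf at h01c h02c
  omega

/-! ## §2 The assembly -/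

/-- **A ranked structure of `(ℤ/L)³` leaving exactly `L³ + 2` plaquettes outside** (`L ≥ 2`): an
injective top-link assignment, links of their plaquettes, ranked — the datum of an exact one-plaquette
heat-bath autoregression on `2L³ − 2` of the `3L³` plaquettes (`Scaling/AutoregressiveGaugeHeatBathRanked`).
[ours] -/
theorem exists_ranked_three_card_compl (hL : 2 ≤ L) :
    ∃ (B : Finset (Plaquette 3 L)) (t : Plaquette 3 L → Edge 3 L) (rank : Plaquette 3 L → ℕ),
      Set.InjOn t B ∧
      (∀ p ∈ B, t p ∈ ({(p.1, p.2.1.1), (p.1.shift p.2.1.1, p.2.1.2),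
        (p.1.shift p.2.1.2, p.2.1.1), (p.1, p.2.1.2)} : Finset (Edge 3 L))) ∧
      (∀ p ∈ B, ∀ p' ∈ B, p ≠ p' → t p ∈ ({(p'.1, p'.2.1.1), (p'.1.shift p'.2.1.1, p'.2.1.2),
        (p'.1.shift p'.2.1.2, p'.2.1.1), (p'.1, p'.2.1.2)} : Finset (Edge 3 L)) → rank p < rank p') ∧
      (Finset.univ \ B).card = L ^ 3 + 2 := by
  refine ⟨_, _, _, threeDim_injOn _ _ rfl rfl, fun p _ => threeDim_mem_links _ rfl p,
    threeDim_rank_lt hL _ _ _ rfl rfl rfl, ?_⟩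
  have hcard := card_threeDim (L := L) _ rfl
  have hP := card_plaquette_three (L := L)
  rw [Finset.card_univ_sdiff, hP]
  omega

/-- **`k_min(3) ∈ {L³ − 1, …, L³ + 2}`**: every ranked structure of `(ℤ/L)³` (`L ≥ 2`) leaves `k ≥ L³ − 1`
plaquettes outside (the parity bound) and some ranked structure leaves exactly `L³ + 2`. [ours] -/
theorem threeDim_gap_le_three (hL : 2 ≤ L) :
    (∀ (B : Finset (Plaquette 3 L)) (t : Plaquette 3 L → Edge 3 L) (rank : Plaquette 3 L → ℕ),
      (∀ p ∈ B, t p ∈ ({(p.1, p.2.1.1), (p.1.shift p.2.1.1, p.2.1.2),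
        (p.1.shift p.2.1.2, p.2.1.1), (p.1, p.2.1.2)} : Finset (Edge 3 L))) →
      (∀ p ∈ B, ∀ p' ∈ B, p ≠ p' → t p ∈ ({(p'.1, p'.2.1.1), (p'.1.shift p'.2.1.1, p'.2.1.2),
        (p'.1.shift p'.2.1.2, p'.2.1.1), (p'.1, p'.2.1.2)} : Finset (Edge 3 L)) → rank p < rank p') →
      L ^ 3 ≤ (Finset.univ \ B).card + 1) ∧
    ∃ (B : Finset (Plaquette 3 L)) (t : Plaquette 3 L → Edge 3 L) (rank : Plaquette 3 L → ℕ),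
      Set.InjOn t B ∧
      (∀ p ∈ B, t p ∈ ({(p.1, p.2.1.1), (p.1.shift p.2.1.1, p.2.1.2),
        (p.1.shift p.2.1.2, p.2.1.1), (p.1, p.2.1.2)} : Finset (Edge 3 L))) ∧
      (∀ p ∈ B, ∀ p' ∈ B, p ≠ p' → t p ∈ ({(p'.1, p'.2.1.1), (p'.1.shift p'.2.1.1, p'.2.1.2),
        (p'.1.shift p'.2.1.2, p'.2.1.1), (p'.1, p'.2.1.2)} : Finset (Edge 3 L)) → rank p < rank p') ∧
      (Finset.univ \ B).card = L ^ 3 + 2 :=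
  ⟨fun B t rank ht hrank => pow_three_le_card_compl_add_one_of_ranked hL B t ht rank hrank,
    exists_ranked_three_card_compl hL⟩

end Summit.Ventures.LatticeQCDFlow.Theory2.Autoregressive
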